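import Summits.QuantumFields.YangMills.Theorems.LangevinControlUVFemtoCurvatureTwoPointCDefsCore

/-!
# Route `LangevinControlUV`, crux `FemtoCurvatureTwoPointC` (stmt-QuantumFields-16204): line `birth`, the longitudinal bridge for stub LU

Line birth reshape (lead c9, wave 1): LU ⟸ transverse UPPER matching (the upper clause of D) + `u`-free LONGITUDINAL
DOMINATION LD.

The birth skeleton `Cruxes/FemtoCurvatureTwoPointC/Lines/birth.lean` cuts the femto-engine statement `AFProfilesCoreAt r`
(`…CDefsCore`) into stubs R (an INTRINSIC asymptotic-freedom box coupling `u` with diagonal matching on window boxes),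
D (finite-volume decoupling: the interior TRANSVERSE matching `c'·u(8n,β)² ≤ n⁸·f_L(n)` (`1 ≤ n`, `8n ≤ L`) and
`s⁸·f_L(s) ≤ C'·u(8s,β)²` (`8 ≤ L`, `1 ≤ s`, `8s ≤ L`) on window boxes, where
`f_L(s) = Cov_{L,β}(P_0^{01}, P_{se₂}^{01})` is the connected plaquette two-point function at separation `s` in the direction
`e₂` TRANSVERSE to the plaquette plane `01`), LU (the LONGITUDINAL upper bound `s⁸·|g_L(s)| ≤ C'·u(8s,β)²` on window boxes,
where `g_L(s) = Cov_{L,β}(P_0^{01}, P_{se₀}^{01})` is the same two-point function in the direction `e₀` INSIDE the plaquette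
plane) and V (variance ceiling). This file proves, sorry-free, the purely logical BRIDGE behind the lead's reshape of LU into
a `u`-free statement:

* `longitudinalUpper_of_longitudinalDomination` — for a GIVEN coupling `u` carrying the R-bundle (hypothesis `hR`, verbatim
  the antecedent of the registered `stub_longitudinalUpper`; it is NOT used in the proof), the conclusion of D (hypothesis
  `hD`: transverse lower matching TL with a constant `0 < c'` and transverse upper matching TU with a constant `C'`, beyond a
  threshold `β₁`) together with the `u`-free LONGITUDINAL DOMINATION (hypothesis `hLD`: `|g_L(s)| ≤ C₂·f_L(s)` for `1 ≤ s`,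
  `8s ≤ L`, `β ≥ β₂`) implies LU's conclusion `s⁸·|g_L(s)| ≤ C''·u(8s,β)²` on window boxes `8 ≤ L`, `1 ≤ s`, `8s ≤ L`
  beyond a threshold.

Proof. Multiply the domination by `s⁸ ≥ 0` and chain with TU:
`s⁸·|g| ≤ C₂·(s⁸·f) ≤ max C₂ 0 · (s⁸·f) ≤ max C₂ 0 · C'·u(8s,β)²`. The middle step needs `0 ≤ s⁸·f`, which is forced by TL at
the same separation (`c'·u(8s,β)² ≤ s⁸·f` with `0 < c'` and `0 ≤ u(8s,β)²`); this is why `max C₂ 0` suffices without any sign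
hypothesis on `C₂` or `C'`, and why the positivity clause of `hR` (whose threshold `β₀` is invisible from `hD` / `hLD`) is
never needed. Witnesses: threshold `max β₁ β₂`, constant `max C₂ 0 · C'`. The real-arithmetic core is the private lemma
`dominate_combine`.

Design. All three hypotheses are kept CHARACTER FOR CHARACTER equal to the registered texts (the lead instantiates this
theorem with the registered stub bodies in the composition of line `birth`). Nothing in this file is physics and nothing is
asserted unconditionally. Deliberately NOT here: LD itself (domination of the longitudinal by the transverse curvature
two-point function; open), R, D, V.
-/

set_option autoImplicit false

noncomputable section

open Filter Topology MeasureTheory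
open Literature.MathematicalPhysics.QuantumFieldTheory

namespace Summit.QuantumFields.YangMills.Theorems.FemtoCurvatureTwoPointC

/-- **Domination combination (pure real arithmetic).** From the transverse two-sided bound `c'·t ≤ N·f ≤ C'·t`
(`0 < c'`, `0 ≤ t`, whence `0 ≤ N·f`), `0 ≤ N`, and the domination `a ≤ C₂·f`: `N·a ≤ (max C₂ 0)·C'·t`. [folklore] -/
private theorem dominate_combine {c' C' C₂ t N f a : ℝ} (hc' : 0 < c') (ht : 0 ≤ t) (hN : 0 ≤ N)
    (hlo : c' * t ≤ N * f) (hhi : N * f ≤ C' * t) (hdom : a ≤ C₂ * f) :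
    N * a ≤ max C₂ 0 * C' * t := by
  have hNf : 0 ≤ N * f := (mul_nonneg hc'.le ht).trans hlo
  calc N * a ≤ N * (C₂ * f) := mul_le_mul_of_nonneg_left hdom hN
    _ = C₂ * (N * f) := by ring
    _ ≤ max C₂ 0 * (N * f) := mul_le_mul_of_nonneg_right (le_max_left _ _) hNf
    _ ≤ max C₂ 0 * (C' * t) := mul_le_mul_of_nonneg_left hhi (le_max_right _ _)
    _ = max C₂ 0 * C' * t := by ring

/-- **LU ⟸ transverse upper matching + longitudinal domination (line `birth` reshape, lead c9; sorry-free bridge).**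
For a compact group `G`, a lattice representation `r`, and a GIVEN box coupling `u : ℕ → ℝ → ℝ` with constants
`u₀ β₀ κ₁ κ₂ κ₃ c C c₈` carrying the R-bundle `hR` (admissibility, continuity, freezing, bare size, in-window comparability,
dyadic AF step law, diagonal matching; verbatim the antecedent of the registered `stub_longitudinalUpper`, and unused here),
D's conclusion `hD` (a threshold `β₁` and constants `0 < c'`, `C'` with the transverse LOWER matching
`c'·u(8n,β)² ≤ n⁸·Cov_{L,β}(P_0^{01}, P_{ne₂}^{01})` for `1 ≤ n`, `8n ≤ L` and the transverse UPPER matching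
`s⁸·Cov_{L,β}(P_0^{01}, P_{se₂}^{01}) ≤ C'·u(8s,β)²` for `8 ≤ L`, `1 ≤ s`, `8s ≤ L`, both on window boxes) and the `u`-free
LONGITUDINAL DOMINATION `hLD` (`|Cov_{L,β}(P_0^{01}, P_{se₀}^{01})| ≤ C₂·Cov_{L,β}(P_0^{01}, P_{se₂}^{01})` for `1 ≤ s`,
`8s ≤ L`, `β ≥ β₂`) imply LU's conclusion: there are `β₁' C''` with
`s⁸·|Cov_{L,β}(P_0^{01}, P_{se₀}^{01})| ≤ C''·u(8s,β)²` for `8 ≤ L`, `1 ≤ s`, `8s ≤ L` on window boxes beyond `β₁'`.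
Witnesses: `β₁' = max β₁ β₂`, `C'' = max C₂ 0 · C'`; TL is used only through the sign `0 ≤ s⁸·Cov_{L,β}(P_0^{01}, P_{se₂}^{01})`.
Stated in `∀`-form (the shape registered as a sub-goal stub of stmt-QuantumFields-16204, so that the `--supports` landing
passes `supports.stub-mismatch`); use as
`longitudinalUpper_of_longitudinalDomination r u u₀ β₀ κ₁ κ₂ κ₃ c C c₈ hR hD hLD`. [folklore] -/
theorem longitudinalUpper_of_longitudinalDomination :
    ∀ {G : Type} [Group G] [TopologicalSpace G] [IsTopologicalGroup G] [CompactSpace G]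
        [MeasurableSpace G] [BorelSpace G] (r : LatticeRep G) (u : ℕ → ℝ → ℝ) (u₀ β₀ κ₁ κ₂ κ₃ c C c₈ : ℝ),
      (0 < u₀ ∧ 0 < c ∧ 0 < κ₁ ∧ 0 ≤ κ₃ ∧ 0 < c₈ ∧
        (∀ (L : ℕ) (β : ℝ), 8 ≤ L → β₀ ≤ β → 0 < u L β) ∧
        (∀ L : ℕ, 8 ≤ L → ContinuousOn (u L) (Set.Ici β₀)) ∧
        (∀ L : ℕ, 8 ≤ L → Filter.Tendsto (u L) Filter.atTop (nhds 0)) ∧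
        (∀ β : ℝ, β₀ ≤ β → c₈ ≤ β * u 8 β) ∧
        (∀ (L L' : ℕ) (β : ℝ), β₀ ≤ β → 8 ≤ L → L ≤ L' → L' ≤ 2 * L →
            (∀ M : ℕ, 8 ≤ M → M ≤ L → u M β ≤ u₀) → |(u L β)⁻¹ - (u L' β)⁻¹| ≤ κ₂) ∧
        (∀ (k m : ℕ) (β : ℝ), β₀ ≤ β → (∀ M : ℕ, 8 ≤ M → M ≤ 8 * 2 ^ (k + m) → u M β ≤ u₀) →
            κ₁ * m - κ₃ ≤ (u (8 * 2 ^ k) β)⁻¹ - (u (8 * 2 ^ (k + m)) β)⁻¹ ∧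
              (u (8 * 2 ^ k) β)⁻¹ - (u (8 * 2 ^ (k + m)) β)⁻¹ ≤ κ₂ * m + κ₃) ∧
        (∀ (L : ℕ) [NeZero L] (β : ℝ), β₀ ≤ β → 8 ≤ L →
            (∀ M : ℕ, 8 ≤ M → M ≤ L → u M β ≤ u₀) →
            ∀ (P : (Fin 4 → ZMod L) → Fin 4 → Fin 4 → GaugeConfig 4 L G → ℝ)
              (E : (GaugeConfig 4 L G → ℝ) → ℝ),
              (P = fun x i j U => (r.N : ℝ) - (r.ρ (plaquetteHolonomy U x i j)).trace.re) →
              (E = fun F => wilsonExpectation r.ρ β F) →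
              c * u L β ^ 2 ≤
                ((L / 8 : ℕ) : ℝ) ^ 8 * (E (fun U => P 0 0 1 U * P (Pi.single (2 : Fin 4) ((L / 8 : ℕ) : ZMod L)) 0 1 U)
                  - E (P 0 0 1) * E (P (Pi.single (2 : Fin 4) ((L / 8 : ℕ) : ZMod L)) 0 1)) ∧
              ((L / 8 : ℕ) : ℝ) ^ 8 * (E (fun U => P 0 0 1 U * P (Pi.single (2 : Fin 4) ((L / 8 : ℕ) : ZMod L)) 0 1 U)
                - E (P 0 0 1) * E (P (Pi.single (2 : Fin 4) ((L / 8 : ℕ) : ZMod L)) 0 1)) ≤ C * u L β ^ 2)) →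
      (∃ (β₁ c' C' : ℝ), 0 < c' ∧
        (∀ (L : ℕ) [NeZero L] (β : ℝ) (n : ℕ), β₁ ≤ β → 1 ≤ n → 8 * n ≤ L →
            (∀ M : ℕ, 8 ≤ M → M ≤ L → u M β ≤ u₀) →
            ∀ (P : (Fin 4 → ZMod L) → Fin 4 → Fin 4 → GaugeConfig 4 L G → ℝ)
              (E : (GaugeConfig 4 L G → ℝ) → ℝ),
              (P = fun x i j U => (r.N : ℝ) - (r.ρ (plaquetteHolonomy U x i j)).trace.re) →
              (E = fun F => wilsonExpectation r.ρ β F) →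
              c' * u (8 * n) β ^ 2 ≤
                (n : ℝ) ^ 8 * (E (fun U => P 0 0 1 U * P (Pi.single (2 : Fin 4) ((n : ℕ) : ZMod L)) 0 1 U)
                  - E (P 0 0 1) * E (P (Pi.single (2 : Fin 4) ((n : ℕ) : ZMod L)) 0 1))) ∧
        (∀ (L : ℕ) [NeZero L] (β : ℝ) (s : ℕ), β₁ ≤ β → 8 ≤ L → 1 ≤ s → 8 * s ≤ L →
            (∀ M : ℕ, 8 ≤ M → M ≤ L → u M β ≤ u₀) →
            ∀ (P : (Fin 4 → ZMod L) → Fin 4 → Fin 4 → GaugeConfig 4 L G → ℝ)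
              (E : (GaugeConfig 4 L G → ℝ) → ℝ),
              (P = fun x i j U => (r.N : ℝ) - (r.ρ (plaquetteHolonomy U x i j)).trace.re) →
              (E = fun F => wilsonExpectation r.ρ β F) →
              (s : ℝ) ^ 8 * (E (fun U => P 0 0 1 U * P (Pi.single (2 : Fin 4) ((s : ℕ) : ZMod L)) 0 1 U)
                  - E (P 0 0 1) * E (P (Pi.single (2 : Fin 4) ((s : ℕ) : ZMod L)) 0 1)) ≤
                C' * u (8 * s) β ^ 2)) →
      (∃ (β₂ C₂ : ℝ), ∀ (L : ℕ) [NeZero L] (β : ℝ) (s : ℕ), β₂ ≤ β → 1 ≤ s → 8 * s ≤ L →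
            ∀ (P : (Fin 4 → ZMod L) → Fin 4 → Fin 4 → GaugeConfig 4 L G → ℝ)
              (E : (GaugeConfig 4 L G → ℝ) → ℝ),
              (P = fun x i j U => (r.N : ℝ) - (r.ρ (plaquetteHolonomy U x i j)).trace.re) →
              (E = fun F => wilsonExpectation r.ρ β F) →
              |E (fun U => P 0 0 1 U * P (Pi.single (0 : Fin 4) ((s : ℕ) : ZMod L)) 0 1 U)
                  - E (P 0 0 1) * E (P (Pi.single (0 : Fin 4) ((s : ℕ) : ZMod L)) 0 1)| ≤
                C₂ * (E (fun U => P 0 0 1 U * P (Pi.single (2 : Fin 4) ((s : ℕ) : ZMod L)) 0 1 U)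
                  - E (P 0 0 1) * E (P (Pi.single (2 : Fin 4) ((s : ℕ) : ZMod L)) 0 1))) →
      ∃ (β₁ C' : ℝ),
        (∀ (L : ℕ) [NeZero L] (β : ℝ) (s : ℕ), β₁ ≤ β → 8 ≤ L → 1 ≤ s → 8 * s ≤ L →
            (∀ M : ℕ, 8 ≤ M → M ≤ L → u M β ≤ u₀) →
            ∀ (P : (Fin 4 → ZMod L) → Fin 4 → Fin 4 → GaugeConfig 4 L G → ℝ)
              (E : (GaugeConfig 4 L G → ℝ) → ℝ),
              (P = fun x i j U => (r.N : ℝ) - (r.ρ (plaquetteHolonomy U x i j)).trace.re) →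
              (E = fun F => wilsonExpectation r.ρ β F) →
              (s : ℝ) ^ 8 * |E (fun U => P 0 0 1 U * P (Pi.single (0 : Fin 4) ((s : ℕ) : ZMod L)) 0 1 U)
                  - E (P 0 0 1) * E (P (Pi.single (0 : Fin 4) ((s : ℕ) : ZMod L)) 0 1)| ≤
                C' * u (8 * s) β ^ 2) := by
  intro G _ _ _ _ _ _ r u u₀ β₀ κ₁ κ₂ κ₃ c C c₈ _ hD hLD
  obtain ⟨β₁, c', C', hc', hTL, hTU⟩ := hD
  obtain ⟨β₂, C₂, hld⟩ := hLD
  refine ⟨max β₁ β₂, max C₂ 0 * C', ?_⟩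
  intro L _ β s hβ hL hs hsL hwin P E hP hE
  have hβ₁ : β₁ ≤ β := (le_max_left _ _).trans hβ
  have hβ₂ : β₂ ≤ β := (le_max_right _ _).trans hβ
  -- transverse LOWER matching at separation `s` on the box `L` (used only for the sign `0 ≤ s⁸·f`)
  have hlo := hTL L β s hβ₁ hs hsL hwin P E hP hE
  -- transverse UPPER matching at separation `s` on the box `L`
  have hhi := hTU L β s hβ₁ hL hs hsL hwin P E hP hE
  -- longitudinal domination at separation `s` on the box `L`
  have hdom := hld L β s hβ₂ hs hsL P E hP hE
  exact dominate_combine hc' (sq_nonneg _) (pow_nonneg (Nat.cast_nonneg s) 8) hlo hhi hdom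

end Summit.QuantumFields.YangMills.Theorems.FemtoCurvatureTwoPointC

end
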